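import Summits.RiemannHypothesis.RiemannHypothesis.Theorems.WeilFormatCCinfCertStagesOdd
import Summits.RiemannHypothesis.RiemannHypothesis.Theorems.WeilFormatCCinfExactTables
import HarnessLib

/-!
# Format C, design C∞ (E2 data side): the ODD sector's FOUR ENTRY-BOX FAMILIES from one claimed table of `S`

Route context: Fourier–Galerkin / Schur-complement certificates of Weil positivity on a window ("format C", C∞ door;
cell memo `run/shared/lean/pub/rh-explicit/rh-explicit-weil-2/gen15/E2-PLAN-v2.md` §6 and the gen16 layout of record,
HOME STATUS 2026-08-25 «weil-2 gen16 STATUS 0»; supporting stmt-RiemannHypothesis-0098; seat rh-explicit-weil-2).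

`WeilFormatC.weilPositivityOn_of_cinf_cert` (`WeilFormatCCinfDoorCert`) takes, for the odd sector, the hypotheses
`hxxo hxβo hβxo hββo`: entrywise `|S(p,p') − [p = p']δ − mid(p,p')·u| ≤ ρZ·u` for the explicit matrix `S` printed there.
Here those four families are produced AT ONCE from

* ONE claimed integer table `SZ` of the glued matrix `CinfStageO.SR` (x-indices first) with its enclosure fact
  `CinfExact.TabNear (SR …) Bo ro cS ρS SZ` (delivered by the integer stages of the composite evaluator),
* the margin written as `δ = DE·u`, `u = 1/2^cu`, and
* ONE Boolean `CinfCertO.checkFinal … = true` (per entry `|SZ − [p=p']·DE·2^(cS−cu) − mid·2^(cS−cu)| + ρS ≤ ρZ·2^(cS−cu)`,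
  exact integers; `decide` in the rung's last kernel file),

stated over ABSTRACT primitives `Kb Fc sq Xr Pf Ip coef Prow Pimg Rtab ρrow ρimg Ge ce wmid Λ1 Λ2 θ We d₁ δ` of the
door's types.  With the door's printed primitives substituted for these heads (`Kb := fun n m ↦ (gramCoeff a (n+1) (m+1) − gramCoeff a (n+1) (−(m+1)))/2`, `Fc := fun j k ↦ (fourierCoeff a (k+1) (1·f_j)).im`,
`sq := √(2a)`, `Xr := fun j m ↦ (W(1f_j, χ⁻_{m+1})).im / √2`, …) the four conclusions ARE the door's `hxxo hxβo hβxo hββo`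
(β-conversion only): text cut from `WeilFormatCCinfDoorCert` 987c40a279bf by substitution (gen16 work/gen/subst_odd.py).
Odd twin of `WeilFormatCCinfCertEven` (same `checkFinal` shape, own namespace).

* `CinfCertO.checkFinal`, `CinfCertO.cert_boxes_odd`.

Bookkeeping only (the glued table's readers + `CinfExact.nearU_of_checkEntryU`); standard axioms; no RH claim.
-/

set_option autoImplicit false
-- `Summit.RiemannHypothesis.RiemannHypothesis.…` is the layout-mandated namespace (summit = problem name).
set_option linter.dupNamespace false

open Finset

namespace Summit.RiemannHypothesis.RiemannHypothesis.Theorems.WeilFormatC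

open Literature.NumberTheory.LFunctions (PsdDyadic.getMZ)

namespace CinfCertO

/-- **The final per-sector check** over the glued `n × n` table (`n = B + r`): for all `p, p' < n`,
`|SZ[p][p'] − [p = p']·DE·2^(cS−cu) − mid[p][p']·2^(cS−cu)| + ρS ≤ ρZ·2^(cS−cu)`. -/
def checkFinal (n cS cu ρS : ℕ) (ρZ DE : ℤ) (SZ mid : List (List ℤ)) : Bool :=
  CinfExact.allFromTo 0 n fun p ↦ CinfExact.allFromTo 0 n fun p' ↦
    CinfExact.checkEntryU cS cu ρZ (PsdDyadic.getMZ SZ p p' - if p = p' then DE * 2 ^ (cS - cu) else 0) ρS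
      (PsdDyadic.getMZ mid p p')

/-- Soundness of `checkFinal`, one entry, in glued indices. -/
theorem near_of_checkFinal {n cS cu ρS : ℕ} (hcu : cu ≤ cS) {ρZ DE : ℤ} {SZ mid : List (List ℤ)}
    (h : checkFinal n cS cu ρS ρZ DE SZ mid = true) {S : ℕ → ℕ → ℝ} (hS : CinfExact.TabNear S n n cS ρS SZ)
    {δ : ℝ} (hδ : δ = (DE : ℝ) * (1 / 2 ^ cu)) {p p' : ℕ} (hp : p < n) (hp' : p' < n) :
    |(S p p' - if p = p' then δ else 0) - (PsdDyadic.getMZ mid p p' : ℝ) * (1 / 2 ^ cu)| ≤ (ρZ : ℝ) * (1 / 2 ^ cu) := by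
  have hc := CinfExact.allFromTo_spec (CinfExact.allFromTo_spec h p (Nat.zero_le _) (by simpa using hp))
    p' (Nat.zero_le _) (by simpa using hp')
  refine CinfExact.nearU_of_checkEntryU hcu ?_ hc
  have h1 := hS.out p hp p' hp'
  have h2 : (0 : ℝ) < 2 ^ cS := by positivity
  have hpow : (2 : ℝ) ^ cS = 2 ^ (cS - cu) * 2 ^ cu := by rw [← pow_add, Nat.sub_add_cancel hcu]
  have hδ' : (if p = p' then δ else 0)
      = ((if p = p' then DE * 2 ^ (cS - cu) else 0 : ℤ) : ℝ) / 2 ^ cS := by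
    by_cases hpp : p = p'
    · rw [if_pos hpp, if_pos hpp, hδ, hpow]; push_cast; field_simp
    · rw [if_neg hpp, if_neg hpp]; simp
  rw [hδ']
  push_cast
  have e : S p p' - ((if p = p' then (DE : ℝ) * 2 ^ (cS - cu) else 0)) / 2 ^ cS
      - ((PsdDyadic.getMZ SZ p p' : ℝ) - (if p = p' then (DE : ℝ) * 2 ^ (cS - cu) else 0)) / 2 ^ cS
      = S p p' - (PsdDyadic.getMZ SZ p p' : ℝ) / 2 ^ cS := by ring
  rw [e]
  exact h1

/-- **The even sector's four entry-box families** (the door's `hxxe hxβe hβxe hββe` over abstract primitive heads) from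
ONE claimed table of the glued matrix `CinfStageO.SR`, the margin `δ = DE·u`, and ONE passing `checkFinal`. -/
theorem cert_boxes_odd {Bo ro D m₀ : ℕ}
    (Kb : ℕ → ℕ → ℝ) (Fc : Fin ro → ℕ → ℝ) (sq : ℝ) (Xr : Fin ro → ℕ → ℝ) (Pf Ip : Fin ro → Fin ro → ℝ)
    (se : Finset ℕ) (coef : Fin ro → ℕ → ℝ) (Prow Pimg : ℕ → Fin 4 × Fin D → ℝ) (Rtab : Fin ro → Fin 4 × Fin D → ℝ)
    (ρrow ρimg : ℕ → ℝ) (Ge : Fin 4 × Fin D → Fin 4 × Fin D → ℝ) (ce : Fin 4 × Fin D → ℝ) (wmid : ℕ → ℝ)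
    (Λ1 : Fin ro → Fin Bo → ℝ) (Λ2 : Fin ro → Fin ro → ℝ) (θ We d₁ δ : ℝ)
    {cS cu ρS : ℕ} (hcu : cu ≤ cS) {SZ mid : List (List ℤ)} {ρZ DE : ℤ}
    (hS : CinfExact.TabNear
      (CinfStageO.SR Bo Kb Fc sq Xr Pf Ip se coef Prow Pimg Rtab ρrow ρimg Ge ce wmid Λ1 Λ2 m₀ θ We d₁)
      (Bo + ro) (Bo + ro) cS ρS SZ)
    (hδ : δ = (DE : ℝ) * (1 / 2 ^ cu))
    (hcheck : checkFinal (Bo + ro) cS cu ρS ρZ DE SZ mid = true) :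
    (∀ i i' : Fin Bo, |((Kb (i : ℕ) (i' : ℕ)
          - ((∑ m ∈ Finset.Ico Bo m₀,
            (Kb (i : ℕ) m
                  - ∑ j, (2 * Fc j m / sq) * Λ1 j i)
            * (Kb (i' : ℕ) m
                  - ∑ j, (2 * Fc j m / sq) * Λ1 j i') / wmid m) + ((1 + θ) * ((∑ f, ∑ f', ((Prow i f - ∑ j, Rtab j f * Λ1 j i)) * ((Prow i' f' - ∑ j, Rtab j f' * Λ1 j i')) * Ge f f')
              + ∑ f, ce f * ((Prow i f - ∑ j, Rtab j f * Λ1 j i)) * ((Prow i' f - ∑ j, Rtab j f * Λ1 j i')))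
            + (1 + 1 / θ) * (We * ((∑ i : Fin Bo, ρrow i
                + ∑ j, (∑ q ∈ se, |coef j q| * ρimg q
                    + ∑ n ∈ Finset.Ico 0 Bo, |(2 * Fc j n / sq)| * ρrow n))))
              * (if i = i' then ρrow i else 0)) / d₁))
          - if i = i' then δ else 0) - (PsdDyadic.getMZ mid i i' : ℝ) * (1 / 2 ^ cu)| ≤ (ρZ : ℝ) * (1 / 2 ^ cu)) ∧
    (∀ (i : Fin Bo) (j₁ : Fin ro), |(((Xr j₁ (i : ℕ)) - ∑ k ∈ Finset.Ico 0 Bo, Kb k (i : ℕ) * (2 * Fc j₁ k / sq))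
            + (Λ1 j₁ i - ∑ j₀, Λ1 j₀ i * (2 * Ip j₀ j₁
                        - ∑ k ∈ Finset.range Bo, (2 * Fc j₀ k / sq) * (2 * Fc j₁ k / sq)))
          - ((∑ m ∈ Finset.Ico Bo m₀,
            (Kb (i : ℕ) m
                  - ∑ j, (2 * Fc j m / sq) * Λ1 j i)
            * (((Xr j₁ m)
                - ∑ k ∈ Finset.Ico 0 Bo, Kb k m * (2 * Fc j₁ k / sq))
                  - ∑ j, (2 * Fc j m / sq) * Λ2 j j₁) / wmid m) + (1 + θ) * ((∑ f, ∑ f', ((Prow i f - ∑ j, Rtab j f * Λ1 j i)) * ((∑ q ∈ se, coef j₁ q * Pimg q f'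
                      - ∑ n ∈ Finset.Ico 0 Bo, (2 * Fc j₁ n / sq) * Prow n f')
                    - ∑ j, Rtab j f' * Λ2 j j₁) * Ge f f')
              + ∑ f, ce f * ((Prow i f - ∑ j, Rtab j f * Λ1 j i)) * ((∑ q ∈ se, coef j₁ q * Pimg q f
                      - ∑ n ∈ Finset.Ico 0 Bo, (2 * Fc j₁ n / sq) * Prow n f)
                    - ∑ j, Rtab j f * Λ2 j j₁)) / d₁))
          - (PsdDyadic.getMZ mid i (Bo + j₁) : ℝ) * (1 / 2 ^ cu)| ≤ (ρZ : ℝ) * (1 / 2 ^ cu)) ∧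
    (∀ (j₁ : Fin ro) (i : Fin Bo), |(((Xr j₁ (i : ℕ)) - ∑ k ∈ Finset.Ico 0 Bo, Kb k (i : ℕ) * (2 * Fc j₁ k / sq))
            + (Λ1 j₁ i - ∑ j₀, Λ1 j₀ i * (2 * Ip j₀ j₁
                        - ∑ k ∈ Finset.range Bo, (2 * Fc j₀ k / sq) * (2 * Fc j₁ k / sq)))
          - ((∑ m ∈ Finset.Ico Bo m₀,
            (((Xr j₁ m)
                - ∑ k ∈ Finset.Ico 0 Bo, Kb k m * (2 * Fc j₁ k / sq))
                  - ∑ j, (2 * Fc j m / sq) * Λ2 j j₁)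
            * (Kb (i : ℕ) m
                  - ∑ j, (2 * Fc j m / sq) * Λ1 j i) / wmid m) + (1 + θ) * ((∑ f, ∑ f', ((∑ q ∈ se, coef j₁ q * Pimg q f
                      - ∑ n ∈ Finset.Ico 0 Bo, (2 * Fc j₁ n / sq) * Prow n f)
                    - ∑ j, Rtab j f * Λ2 j j₁) * ((Prow i f' - ∑ j, Rtab j f' * Λ1 j i)) * Ge f f')
              + ∑ f, ce f * ((∑ q ∈ se, coef j₁ q * Pimg q f
                      - ∑ n ∈ Finset.Ico 0 Bo, (2 * Fc j₁ n / sq) * Prow n f)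
                    - ∑ j, Rtab j f * Λ2 j j₁) * ((Prow i f - ∑ j, Rtab j f * Λ1 j i))) / d₁))
          - (PsdDyadic.getMZ mid (Bo + j₁) i : ℝ) * (1 / 2 ^ cu)| ≤ (ρZ : ℝ) * (1 / 2 ^ cu)) ∧
    (∀ j₁ j₂ : Fin ro, |(((Pf j₁ j₂
                      - ∑ k ∈ Finset.Ico 0 Bo, (2 * Fc j₂ k / sq) * (Xr j₁ k)
                      - ∑ k ∈ Finset.Ico 0 Bo, (2 * Fc j₁ k / sq) * (Xr j₂ k)
                      + ∑ k ∈ Finset.Ico 0 Bo, (2 * Fc j₂ k / sq) * ∑ k' ∈ Finset.Ico 0 Bo, Kb k' k * (2 * Fc j₁ k' / sq))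
            + (Λ2 j₂ j₁ + Λ2 j₁ j₂ - ∑ j₀, Λ2 j₀ j₁ * (2 * Ip j₀ j₂
                        - ∑ k ∈ Finset.range Bo, (2 * Fc j₀ k / sq) * (2 * Fc j₂ k / sq)) - ∑ j₀, Λ2 j₀ j₂ * (2 * Ip j₀ j₁
                        - ∑ k ∈ Finset.range Bo, (2 * Fc j₀ k / sq) * (2 * Fc j₁ k / sq)))
          - ((∑ m ∈ Finset.Ico Bo m₀,
            (((Xr j₁ m)
                - ∑ k ∈ Finset.Ico 0 Bo, Kb k m * (2 * Fc j₁ k / sq))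
                  - ∑ j, (2 * Fc j m / sq) * Λ2 j j₁)
            * (((Xr j₂ m)
                - ∑ k ∈ Finset.Ico 0 Bo, Kb k m * (2 * Fc j₂ k / sq))
                  - ∑ j, (2 * Fc j m / sq) * Λ2 j j₂) / wmid m) + ((1 + θ) * ((∑ f, ∑ f', ((∑ q ∈ se, coef j₁ q * Pimg q f
                      - ∑ n ∈ Finset.Ico 0 Bo, (2 * Fc j₁ n / sq) * Prow n f)
                    - ∑ j, Rtab j f * Λ2 j j₁) * ((∑ q ∈ se, coef j₂ q * Pimg q f'
                      - ∑ n ∈ Finset.Ico 0 Bo, (2 * Fc j₂ n / sq) * Prow n f')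
                    - ∑ j, Rtab j f' * Λ2 j j₂) * Ge f f')
              + ∑ f, ce f * ((∑ q ∈ se, coef j₁ q * Pimg q f
                      - ∑ n ∈ Finset.Ico 0 Bo, (2 * Fc j₁ n / sq) * Prow n f)
                    - ∑ j, Rtab j f * Λ2 j j₁) * ((∑ q ∈ se, coef j₂ q * Pimg q f
                      - ∑ n ∈ Finset.Ico 0 Bo, (2 * Fc j₂ n / sq) * Prow n f)
                    - ∑ j, Rtab j f * Λ2 j j₂))
            + (1 + 1 / θ) * (We * ((∑ i : Fin Bo, ρrow i
                + ∑ j, (∑ q ∈ se, |coef j q| * ρimg q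
                    + ∑ n ∈ Finset.Ico 0 Bo, |(2 * Fc j n / sq)| * ρrow n))))
              * (if j₁ = j₂ then (∑ q ∈ se, |coef j₁ q| * ρimg q
                    + ∑ n ∈ Finset.Ico 0 Bo, |(2 * Fc j₁ n / sq)| * ρrow n) else 0)) / d₁))
          - if j₁ = j₂ then δ else 0) - (PsdDyadic.getMZ mid (Bo + j₁) (Bo + j₂) : ℝ) * (1 / 2 ^ cu)| ≤ (ρZ : ℝ) * (1 / 2 ^ cu)) := by
  have key := fun p p' (hp : p < Bo + ro) (hp' : p' < Bo + ro) ↦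
    near_of_checkFinal hcu hcheck hS hδ hp hp'
  refine ⟨fun i i' ↦ ?_, fun i j₁ ↦ ?_, fun j₁ i ↦ ?_, fun j₁ j₂ ↦ ?_⟩
  · have h := key i i' (by omega) (by omega)
    rw [CinfStageO.SR_xx] at h
    have e : (if (i : ℕ) = (i' : ℕ) then δ else 0) = if i = i' then δ else 0 := by
      simp only [Fin.val_inj]
    rw [e] at h
    dsimp only [CinfStageO.SxxR, CinfStageO.TxxR, CinfStageO.HxxR, CinfStageO.RtotR, CinfStageO.gxR,
      CinfStageO.AxR, CinfStageO.VR] at h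
    exact h
  · have h := key i (Bo + j₁) (by omega) (by omega)
    rw [CinfStageO.SR_xb] at h
    have e : (if (i : ℕ) = Bo + (j₁ : ℕ) then δ else 0) = 0 := if_neg (by omega)
    rw [e, sub_zero] at h
    dsimp only [CinfStageO.SxbR, CinfStageO.CxR, CinfStageO.ER, CinfStageO.TxbR, CinfStageO.HxbR,
      CinfStageO.gxR, CinfStageO.gbR, CinfStageO.AxR, CinfStageO.AbR, CinfStageO.VR] at h
    exact h
  · have h := key (Bo + j₁) i (by omega) (by omega)
    rw [CinfStageO.SR_bx] at h
    have e : (if Bo + (j₁ : ℕ) = (i : ℕ) then δ else 0) = 0 := if_neg (by omega)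
    rw [e, sub_zero] at h
    dsimp only [CinfStageO.SbxR, CinfStageO.CxR, CinfStageO.ER, CinfStageO.TbxR, CinfStageO.HbxR,
      CinfStageO.gxR, CinfStageO.gbR, CinfStageO.AxR, CinfStageO.AbR, CinfStageO.VR] at h
    exact h
  · have h := key (Bo + j₁) (Bo + j₂) (by omega) (by omega)
    rw [CinfStageO.SR_bb] at h
    have e : (if Bo + (j₁ : ℕ) = Bo + (j₂ : ℕ) then δ else 0) = if j₁ = j₂ then δ else 0 := by
      simp only [add_right_inj, Fin.val_inj]
    rw [e] at h
    dsimp only [CinfStageO.SbbR, CinfStageO.PbbR, CinfStageO.L2R, CinfStageO.ER, CinfStageO.TbbR,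
      CinfStageO.HbbR, CinfStageO.RtotR, CinfStageO.rtilR, CinfStageO.gbR, CinfStageO.AbR, CinfStageO.VR] at h
    exact h

end CinfCertO

end Summit.RiemannHypothesis.RiemannHypothesis.Theorems.WeilFormatC
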